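import Literature.NumberTheory.EllipticCurves.Rank1Residual.Typed.KolyvaginCertificate
import Literature.NumberTheory.EllipticCurves.Rank1Residual.X10Proofs
import HarnessLib

/-!
# Class X10 at `p = 3`: the image-free per-curve certificate shape `Ш(E/ℚ)[3] = 0 ⇒ BSD(E,3)` (cell `b2b-bsdres`)

HONEST FRAMING (run/shared/lean/b2b/bsd-rank1-residual/, verbatim): the goal of the cell is to
DELETE the COMBINATION-SHAPED residual classes for ALL analytic-rank `≤ 1` elliptic curves over `ℚ`
— "full BSD formula for every rank `≤ 1` curve in class C" assembled STRICTLY from published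
theorems — so that the rank-`≤ 1` remainder becomes exactly the CONSTRUCTION-SHAPED classes, which
are TYPED (missing-input `Prop`s), NOT attempted. This is not "finishing BSD".

Theorems only (no definition, no new named fact). The canonical X10 shape of x11a gen 3's class-free
certificate theorem `Typed.bsdp_of_shaAn_unit_of_noPTorsion` (p179182: Gross–Zagier–Kolyvagin +
`r_an ≤ 1` + `p ∤ #Ш_an` + the finite certificate "every `p`-torsion class of `Ш(E/ℚ)` is `0`" ⇒
`BSD(E,p)`), for BOTH halves of class X10 (`p = 3` good ordinary, `E[3]` irreducible, off the printed
floor):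

* X10a′ (`surj(3)`): the certificate `Ш(E)[3] = 0` is what an explicit `3`-descent
  `dim_𝔽₃ Sel^(3)(E/ℚ) = rank E(ℚ)` gives (with `E(ℚ)[3] = 0`, automatic from `E[3]` irreducible) —
  x10 gen 3's 117/117 rank-one certificates (HOME/X10-AUDIT.md §9.10–9.11, engine of x11b gen 4,
  Schaefer–Stoll 2004) — and, independently, what the `3`-adic certificate of
  `Typed/PAdicCertificateGoodOrdinary.lean` (x10 gen 4, p184219) gives;
* X10b (`¬surj(3)`; on the census below `10⁴` the mod-`3` image is `3Ns`, the normaliser of a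
  SPLIT Cartan subgroup — HOME/b2b-bsdres-lit/X10B-CM3.md, Cremona/LMFDB galrep labels; corrected
  from "non-split" per referee flag `X10b-3Ns-docstring`, R41.4 — CONSTRUCTION-SHAPED as a class,
  referee G26: every printed or announced `p`-part theorem at a good ordinary `3` carries (surj),
  (Im) or (ram), impossible here): the `3`-descent needs NO image hypothesis, so the SAME shape
  closes an X10b pair per curve from GZK + the certificate (x10 gen 4, job x10g4-desc3-x10b on the 10
  census pairs `N < 2·10⁴`; the one pair with `#Ш_an = 9`, 10082b1, is NOT of this shape — there the
  certificate is a LOWER bound `dim Ш[3] ≥ 2` and no published upper bound exists without (surj)).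

Nothing here changes a label: per curve; NOT a class theorem; the lane books certificates.

* `X10.bsdp_three_of_noThreeTorsion` — `ClassX10 W 3 → (∀ x ∈ Ш(E/ℚ), 3x = 0 → x = 0) → 3 ∤ #Ш_an → BSDp W 3`.
* `X10.missingPPartAt_three_of_noThreeTorsion` — the same conclusion in the typed vocabulary
  (`MissingPPartAt W 3`, `Typed/Basic.lean`), so that `Typed/X10.lean`'s `X10.MissingInputAt`
  (`¬Surj W 3 → MissingPPartAt W 3`) is DISCHARGED per curve by the certificate on X10b.

References: [Miller2011LMS] Def. 1.1; Darmon CBMS 101 Thm. 3.22 (GZK); Schaefer–Stoll, Trans. AMS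
356 (2004) (the descent whose output is the certificate; not an input of the kernel).
-/

set_option autoImplicit false

noncomputable section

open scoped Classical

open WeierstrassCurve Literature.NumberTheory.EllipticCurves
  Literature.NumberTheory.EllipticCurves.Rank1Residual

namespace Literature.NumberTheory.EllipticCurves.Rank1Residual.Typed

/-- **X10, per curve, image-free: `ClassX10 W 3 → Ш(E/ℚ)[3] = 0 → 3 ∤ #Ш_an → BSDp W 3`.** Named
fact: Gross–Zagier–Kolyvagin (`hGZK`; the class has `r_an ≤ 1`). Computed per curve: the lane's exact
`#Ш_an` (`hs`, `hv`) and the finite certificate `h` (e.g. an explicit `3`-descent with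
`dim Sel^(3) = rank`, or the `3`-adic certificate of `X10.bsdp_three_of_kato_of_leadingTerm_certificate`
on X10a′). Valid on X10a′ AND on X10b (no `Surj`, (Im) or (ram) hypothesis). Per curve; NOT a class
theorem. [cite: Miller2011LMS, §1 Def. 1.1] -/
theorem X10.bsdp_three_of_noThreeTorsion (hGZK : rank_eq_analyticRank_of_analyticRank_le_one)
    (W : WeierstrassCurve ℚ) [W.IsElliptic] [W.IsGloballyMinimal] (hX : ClassX10 W 3)
    (h : ∀ x : W.sha, (3 : ℤ) • x = 0 → x = 0)
    {s : ℚ} (hs : shaAn W = (s : ℂ)) (hv : padicValRat 3 s = 0) : BSDp W 3 :=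
  bsdp_of_shaAn_unit_of_noPTorsion W 3 hGZK hX.analyticRank_le_one hs hv (by exact_mod_cast h)

/-- **The typed form**: on class X10 the certificate `Ш(E/ℚ)[3] = 0` together with `3 ∤ #Ш_an` gives
`MissingPPartAt W 3` (the exact `3`-part statement of `Typed/Basic.lean`), hence discharges
`X10.MissingInputAt W` of `Typed/X10.lean` at that curve whatever its mod-`3` image. Per curve.
[cite: Miller2011LMS, §1 Def. 1.1] -/
theorem X10.missingPPartAt_three_of_noThreeTorsion
    (hGZK : rank_eq_analyticRank_of_analyticRank_le_one)
    (W : WeierstrassCurve ℚ) [W.IsElliptic] [W.IsGloballyMinimal] (hX : ClassX10 W 3)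
    (h : ∀ x : W.sha, (3 : ℤ) • x = 0 → x = 0)
    {s : ℚ} (hs : shaAn W = (s : ℂ)) (hv : padicValRat 3 s = 0) : MissingPPartAt W 3 :=
  missingPPartAt_of_shaAn_unit_of_noPTorsion W 3 (hGZK W hX.analyticRank_le_one).2 hs hv
    (by exact_mod_cast h)

end Literature.NumberTheory.EllipticCurves.Rank1Residual.Typed

end
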